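import Summits.AtomisticToContinuum.Crystallization.Theorems.ChartedZeroExcessLayeredLatticeLiouvilleZNA

/-!
# Part ZO «Parallel registration: basis, witnesses, cross structure, the linear chart» (lens-2 g79, NODE 79 — part 3a)

Continuation of parts ZN, ZNA (namespace `ParCfg`, hypotheses `ParCfg.Hyp`):

* ZO-1 THE BASIS (`Basis`, `Hyp.exists_basis`): the first two partner differences `b₁, b₂` at a good atom; every in-sheet lattice vector of length
  `≤ 28/25` is `0` or one of the six `latVec b₁ b₂ (loDir k)` (short vectors + hexagon, part ZN), `b₁, b₂` are independent (lengths, part ZM) and — THE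
  LATTICE LEMMA of part ZM — `ℤc₁ + ℤc₂ = ℤb₁ + ℤb₂` (`Basis.coords`).
* ZO-2 LAYER WITNESSES (`Hyp.witness`, `Hyp.ball_layer`): every crystal site of the `RC`-ball has, after finitely many steps `+ b₁` inside its layer,
  a registered GOOD atom; hence all its skeleton representatives have ONE layer index `σ k`, with a good atom in sheet `k`.
* ZO-3 THE CROSS STRUCTURE (`Hyp.exists_TP`): above a good atom of sheet `k` the bonds between layers `σ k` and `σ (k+1)` are EXACTLY the letter
  triangles `c' − c ∈ Δ + latVec b₁ b₂ (triVert t ·)` for one inter-layer vector `Δ` and one letter `t` (transfer lemma + `unit_triangle_aux`), at every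
  base point of the layer (position independence: layers are lattice cosets).
* ZO-4 ★★★ THE LINEAR CHART (`Hyp.linear_chart`): origins `o (k+1) = o k + Δ k`, basis `b₁, b₂`, letters `! t k`: `linChart o b₁ b₂` is an EXACT Barlow bond
  chart of the crystal on the `RC`-ball about `x₀`, onto the ball sites, and a moat atom of sheet `s` within `ε` of a chart site lies in chart sheet `s`.

0 sorry; standard axioms.
-/

noncomputable section
open scoped BigOperators Classical InnerProductSpace RealInnerProductSpace
open MeasureTheory Set Metric Filter Topology
open Summit.AtomisticToContinuum.Crystallization.Theorems.ChartedPlanarOrderRigidityDoor (E3 IsClean IsCharted)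
open Summit.AtomisticToContinuum.Crystallization.Theorems.ChartedPlanarOrderDensityDichotomy (μS IsSep)
open Summit.AtomisticToContinuum.Crystallization.Theorems.ChartedPlanarOrderCleanScaleP (IsCleanP IsDoorSetP isCleanP_one_iff isCleanP_μS_iff)
open Summit.AtomisticToContinuum.Crystallization.Theorems.ChartedPlanarOrderMesoCut (LayeredHom EnvClose)
open Summit.AtomisticToContinuum.Crystallization.Theorems.ChartedPlanarOrderDoorLayeredOsc (IsTwoShellAffineGood mem_iff_μS_singleton_ne_zero)
open Literature.MathematicalPhysics.StatisticalMechanics (lennardJones triangularVec₁ triangularVec₂)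
open Literature.Geometry.DiscreteGeometry (IsTwoShellGoodSet)

namespace Summit.AtomisticToContinuum.Crystallization.Theorems.ChartedZeroExcessLayeredLatticeLiouville

/-- two distinct vertices of a letter triangle differ by a Löschian direction. [formal bookkeeping, `decide`] -/
theorem triVert_pair : ∀ (τ : Bool) (i j : Fin 3), i ≠ j → ∃ m : Fin 6, triVert τ j = triVert τ i + loDir m := by
  decide

namespace ParCfg

variable {G : ParCfg}

/-! ### ZO-1  The basis -/

/-- ★ a BASIS of the in-sheet lattice adapted to the bond scale. -/
structure Basis (G : ParCfg) (b₁ b₂ : E3) : Prop where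
  /-- lattice vectors -/
  lat₁ : G.IsLat b₁
  /-- lattice vectors -/
  lat₂ : G.IsLat b₂
  /-- short lattice vectors are the hexagon -/
  sv : ∀ v, G.IsLat v → ‖v‖ ≤ 28 / 25 → v = 0 ∨ ∃ k : Fin 6, v = latVec b₁ b₂ (loDir k)
  /-- hexagon lengths -/
  nd : ∀ k : Fin 6, G.σC ≤ ‖latVec b₁ b₂ (loDir k)‖ ∧ ‖latVec b₁ b₂ (loDir k)‖ ≤ G.βC
  /-- the sum is not short -/
  na : G.σC ≤ ‖b₁ + b₂‖

/-- ★ a basis exists: the first two partner differences at a good atom. [this file] -/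
theorem Hyp.exists_basis (hG : G.Hyp) : ∃ b₁ b₂, G.Basis b₁ b₂ := by
  obtain ⟨x, hx⟩ := hG.exists_good
  have hex := hG.nv_hex hx
  refine ⟨G.nv x 0, G.nv x 1, hG.nv_isLat hx 0, hG.nv_isLat hx 1, fun v hv h1 => ?_, fun k => ?_, ?_⟩
  · by_cases h0 : v = 0
    · exact Or.inl h0
    · obtain ⟨j, hj⟩ := hG.sv_at hx hv h0 h1
      exact Or.inr ⟨j, by rw [hj, hex j]⟩
  · rw [← hex k]; exact hG.norm_nv hx k
  · have h3 : G.nv x 3 = -G.nv x 0 := by rw [hex 3]; simp [latVec, loDir]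
    have : G.nv x 0 + G.nv x 1 = G.nv x 1 - G.nv x 3 := by rw [h3]; abel
    rw [this]
    exact hG.norm_nv_sub hx (by decide)

/-- the basis vectors are independent over `ℝ`. [formal bookkeeping] -/
theorem Basis.indep (hG : G.Hyp) {b₁ b₂ : E3} (hB : G.Basis b₁ b₂) (s t : ℝ) (h : s • b₁ + t • b₂ = 0) : s = 0 ∧ t = 0 := by
  have h₁ := hB.nd 0
  have h₂ := hB.nd 1
  have hs := hB.nd 5
  simp only [latVec, loDir, Matrix.cons_val] at h₁ h₂ hs
  norm_num at h₁ h₂ hs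
  rw [← sub_eq_add_neg] at hs
  exact latVec_real_indep hG.σC_pos hG.e5 h₁.1 h₁.2 h₂.1 h₂.2 hs.1 hB.na h

/-- integer coordinates in the basis are unique. [formal bookkeeping] -/
theorem Basis.inj (hG : G.Hyp) {b₁ b₂ : E3} (hB : G.Basis b₁ b₂) : Function.Injective (latVec b₁ b₂) := latVec_injective (hB.indep hG)

/-- basis lattice vectors are lattice vectors. [formal bookkeeping] -/
theorem Basis.isLat {b₁ b₂ : E3} (hB : G.Basis b₁ b₂) (p : ℤ × ℤ) : G.IsLat (latVec b₁ b₂ p) := by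
  obtain ⟨A₁, h₁⟩ := hB.lat₁
  obtain ⟨A₂, h₂⟩ := hB.lat₂
  exact ⟨p.1 • A₁ + p.2 • A₂, by rw [h₁, h₂, latVec_latVec]⟩

/-- ★ THE LATTICE LEMMA, applied: every in-sheet lattice vector has integer coordinates in the basis. [this file] -/
theorem Basis.coords (hG : G.Hyp) {b₁ b₂ : E3} (hB : G.Basis b₁ b₂) {v : E3} (hv : G.IsLat v) : ∃ p : ℤ × ℤ, v = latVec b₁ b₂ p := by
  obtain ⟨q₀, rfl⟩ := hv
  obtain ⟨A₁, h₁⟩ := hB.lat₁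
  obtain ⟨A₂, h₂⟩ := hB.lat₂
  have n₁ := hB.nd 0
  have n₂ := hB.nd 1
  have ns := hB.nd 5
  simp only [latVec, loDir, Matrix.cons_val] at n₁ n₂ ns
  norm_num at n₁ n₂ ns
  rw [← sub_eq_add_neg] at ns
  exact lattice_coords hG.σC_pos hG.e5 (by linarith [hG.e4, hG.ε0]) n₁.1 n₁.2 n₂.1 n₂.2 ns.1 hB.na A₁ A₂ h₁ h₂
    (fun q hq => hB.sv _ ⟨q, rfl⟩ hq) q₀

/-- short lattice vectors versus bonds. [formal bookkeeping] -/
theorem Basis.short_iff (hG : G.Hyp) {b₁ b₂ : E3} (hB : G.Basis b₁ b₂) {v : E3} (hv : G.IsLat v) :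
    (0 < ‖v‖ ∧ ‖v‖ ≤ 28 / 25) ↔ ∃ k : Fin 6, v = latVec b₁ b₂ (loDir k) := by
  constructor
  · rintro ⟨h0, h1⟩
    rcases hB.sv v hv h1 with h | h
    · rw [h, norm_zero] at h0; exact (lt_irrefl _ h0).elim
    · exact h
  · rintro ⟨k, rfl⟩
    have := hB.nd k
    exact ⟨by linarith [hG.σC_pos], by linarith [hG.e4, hG.ε0]⟩

/-! ### ZO-2  Layer witnesses -/

/-- ★★ **LAYER WITNESSES.**  Every crystal site `c` of the `RC`-ball has a good atom registered to `c + n • b₁` for some `n : ℕ`: if `d(c) ≥ W₁ + ε` the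
site itself is registered to a good atom; otherwise walk `c, c + b₁, c + 2b₁, …` inside the layer (separated, hence unbounded; steps `≤ βC`) to the
first site with `d ≥ W₁ + ε`. [this file] -/
theorem Hyp.witness (hG : G.Hyp) {b₁ b₂ : E3} (hB : G.Basis b₁ b₂) {c : E3} (hc : c ∈ G.C) (hd : dist c G.x₀ ≤ G.RC) :
    ∃ n : ℕ, ∃ z, G.Good z ∧ dist (G.Ψ z) (c + (n : ℝ) • b₁) ≤ G.ε := by
  have hb₁ := hB.nd 0
  rw [show latVec b₁ b₂ (loDir 0) = b₁ by simp [latVec, loDir]] at hb₁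
  obtain ⟨yc, rfl⟩ := hc
  have hlay : ∀ n : ℕ, G.skel yc + (n : ℝ) • b₁ ∈ G.layer yc.1 := fun n => G.layer_add (G.skel_mem_layer yc) (G.isLat_nsmul hB.lat₁ n)
  by_cases h : G.W₁ + G.ε ≤ dist (G.skel yc) G.x₀
  · obtain ⟨a, ha, hac⟩ := hG.exists_S (G.skel_mem yc) (by linarith [hG.z2, hG.ε0, hb₁.1, hb₁.2, hG.σC_pos])
      (by linarith [hG.z9, hG.z6, hG.ε0])
    obtain ⟨z, rfl⟩ := hG.surj a ha
    refine ⟨0, z, ⟨?_, ?_⟩, by simpa using hac⟩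
    · linarith [dist_triangle (G.skel yc) (G.Ψ z) G.x₀, dist_comm (G.skel yc) (G.Ψ z)]
    · linarith [dist_triangle (G.Ψ z) (G.skel yc) G.x₀, hG.z9]
  · rw [not_le] at h
    set g : ℕ → E3 := fun n => G.skel yc + (n : ℝ) • b₁ with hgdef
    have hgs : ∀ n : ℕ, g (n + 1) - g n = b₁ := fun n => by simp only [hgdef]; push_cast; rw [add_smul, one_smul]; abel
    have hstep : ∀ n, dist (g (n + 1)) G.x₀ ≤ dist (g n) G.x₀ + G.βC := fun n => by
      have : dist (g (n + 1)) (g n) = ‖b₁‖ := by rw [dist_eq_norm, hgs]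
      linarith [dist_triangle (g (n + 1)) (g n) G.x₀, hb₁.2]
    have hsep : ∀ m n : ℕ, m ≠ n → G.σC ≤ dist (g m) (g n) := by
      intro m n hmn
      refine hG.sep _ (G.layer_sub (hlay m)) _ (G.layer_sub (hlay n)) (fun e => hmn ?_)
      have e' : ((m : ℝ) - n) • b₁ = 0 := by
        rw [sub_smul]
        exact sub_eq_zero.2 (add_left_cancel e)
      rcases smul_eq_zero.1 e' with h1 | h1
      · exact_mod_cast sub_eq_zero.1 h1
      · rw [h1, norm_zero] at hb₁; linarith [hG.σC_pos]
    obtain ⟨n, hn⟩ := exists_far_of_sep hG.σC_pos hsep G.x₀ (G.W₁ + G.ε)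
    obtain ⟨n, hn1, hn2⟩ := discrete_ivt (f := fun n => dist (g n) G.x₀) (by simpa [hgdef] using h) ⟨n, hn.le⟩ hstep
    obtain ⟨a, ha, hac⟩ := hG.exists_S (G.layer_sub (hlay n)) (by linarith [hG.z2, hG.ε0, hb₁.1, hG.σC_pos])
      (by linarith [hG.z4, hG.z6, hG.e4, hG.ε0])
    obtain ⟨z, rfl⟩ := hG.surj a ha
    refine ⟨n, z, ⟨?_, ?_⟩, hac⟩
    · linarith [dist_triangle (g n) (G.Ψ z) G.x₀, dist_comm (g n) (G.Ψ z)]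
    · linarith [dist_triangle (G.Ψ z) (g n) G.x₀, hG.z4, hG.e4]

/-- ★ BALL SITES HAVE ONE LAYER INDEX, `σ` of the sheet of a good atom. [this file] -/
theorem Hyp.ball_layer (hG : G.Hyp) {b₁ b₂ : E3} (hB : G.Basis b₁ b₂) {c : E3} (hc : c ∈ G.C) (hd : dist c G.x₀ ≤ G.RC) :
    ∃ z, G.Good z ∧ ∀ m, c ∈ G.layer m → m = G.σ z.1 := by
  obtain ⟨n, z, hz, hzc⟩ := hG.witness hB hc hd
  exact ⟨z, hz, fun m hm => hG.eq_σ_of_near_layer (hG.reg_of_good hz) (G.layer_add hm (G.isLat_nsmul hB.lat₁ n)) hzc⟩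

/-! ### ZO-3  The cross structure above a good atom -/

/-- the three upper Barlow neighbours of a chart point. -/
def up (G : ParCfg) (z : ℤ × ℤ × ℤ) (i : Fin 3) : ℤ × ℤ × ℤ := (z.1 + 1, z.2 - triVert (G.τ z.1) i)

/-- they are Barlow neighbours. [formal bookkeeping] -/
theorem adj_up (G : ParCfg) (z : ℤ × ℤ × ℤ) (i : Fin 3) : BarlowAdj G.τ z (G.up z i) := Or.inr (Or.inl ⟨rfl, i, by simp [up]⟩)

/-- an upper Barlow neighbour is one of the three. [formal bookkeeping] -/
theorem eq_up_of_adj (G : ParCfg) {z y : ℤ × ℤ × ℤ} (hb : BarlowAdj G.τ z y) (h1 : y.1 = z.1 + 1) : ∃ i, y = G.up z i := by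
  rcases hb with ⟨h, -⟩ | ⟨-, i, hi⟩ | ⟨h, -⟩
  · omega
  · exact ⟨i, Prod.ext h1 (by rw [up, hi, add_sub_cancel_right])⟩
  · omega

/-- THE CROSS PROPERTY between chart sheets `k` and `k+1`: one inter-layer vector `Δ` (in the right coset) and one letter `t` describe all bonds. -/
def TP (G : ParCfg) (b₁ b₂ : E3) (k : ℤ) (Δ : E3) (t : Bool) : Prop :=
  G.IsLat (Δ - (G.u (G.σ (k + 1)) - G.u (G.σ k))) ∧
    ∀ c ∈ G.layer (G.σ k), ∀ c' ∈ G.layer (G.σ (k + 1)), IsBond c c' ↔ ∃ i : Fin 3, c' - c = Δ + latVec b₁ b₂ (triVert t i)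

/-- bonds only see the difference vector. [formal bookkeeping] -/
theorem isBond_iff_of_sub_eq {c c' d d' : E3} (h : c' - c = d' - d) : IsBond c c' ↔ IsBond d d' := by
  have : dist c c' = dist d d' := by rw [dist_eq_norm, dist_eq_norm, ← norm_neg, neg_sub, h, ← norm_neg, neg_sub]
  rw [IsBond, IsBond, this]

/-- ★★ **THE CROSS STRUCTURE ABOVE A GOOD ATOM.**  For a good chart point `z` of sheet `k`, the bonds between layers `σ k` and `σ (k+1)` are exactly
`c' − c ∈ Δ + latVec b₁ b₂ (triVert t (Fin 3))`: at the partner of `Ψ z` the bonded sites of layer `σ (k+1)` are the partners of the three upper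
Barlow neighbours (transfer lemma + parallel registration), which form a unit triangle of `ℤb₁ + ℤb₂`, i.e. a letter triangle (`unit_triangle_aux`);
and the description is invariant under the lattice translations of the two layers. [this file] -/
theorem Hyp.exists_TP (hG : G.Hyp) {b₁ b₂ : E3} (hB : G.Basis b₁ b₂) {z : ℤ × ℤ × ℤ} (hz : G.Good z) : ∃ Δ t, G.TP b₁ b₂ z.1 Δ t := by
  have hzr := hG.reg_of_good hz
  have hur : ∀ i, G.RegAt (G.up z i) := fun i => hG.reg_of_adj hz (G.adj_up z i)
  set p := G.ptn (G.Ψ z) with hpdef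
  set P : Fin 3 → E3 := fun i => G.ptn (G.Ψ (G.up z i)) with hPdef
  have hpL : p ∈ G.layer (G.σ z.1) := hG.ptn_layer hzr
  have hPL : ∀ i, P i ∈ G.layer (G.σ (z.1 + 1)) := fun i => hG.ptn_layer (hur i)
  -- pairwise differences of the three partners are hexagon vectors
  have hpair : ∀ i j, i ≠ j → ∃ m : Fin 6, P j - P i = latVec b₁ b₂ (loDir m) := by
    intro i j hij
    obtain ⟨m, hm⟩ := triVert_pair (G.τ z.1) j i (Ne.symm hij)
    have hb : BarlowAdj G.τ (G.up z i) (G.up z j) := Or.inl ⟨rfl, m, by simp only [up]; rw [hm]; abel⟩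
    have hd := hG.ptn_bond (hur i) (hur j) hb
    rw [dist_comm, dist_eq_norm] at hd
    exact (hB.short_iff hG (G.isLat_of_layer (hPL i) (hPL j))).1 ⟨hd.1, hd.2.trans (by linarith [hG.e4, hG.ε0])⟩
  obtain ⟨m₁, hm₁⟩ := hpair 0 1 (by decide)
  obtain ⟨m₂, hm₂⟩ := hpair 0 2 (by decide)
  obtain ⟨m₃, hm₃⟩ := hpair 1 2 (by decide)
  have hadj : CycAdj m₁ m₂ := by
    rw [← loAdj_loDir_iff]
    refine ⟨m₃, hB.inj hG ?_⟩
    rw [latVec_add, ← hm₁, ← hm₃, ← hm₂]; abel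
  obtain ⟨i₀, t, hW1, hW2⟩ := unit_triangle_aux m₁ m₂ hadj
  have hW : ∀ i : Fin 3, P i - P 0 = latVec b₁ b₂ (![(0 : ℤ × ℤ), loDir m₁, loDir m₂] i) := by
    intro i
    fin_cases i
    · simp [latVec_zero]
    · simpa using hm₁
    · simpa using hm₂
  refine ⟨P 0 - p + latVec b₁ b₂ (![(0 : ℤ × ℤ), loDir m₁, loDir m₂] i₀), t, ?_, ?_⟩
  · have : P 0 - p + latVec b₁ b₂ (![(0 : ℤ × ℤ), loDir m₁, loDir m₂] i₀) - (G.u (G.σ (z.1 + 1)) - G.u (G.σ z.1)) =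
        (P 0 - G.u (G.σ (z.1 + 1))) - (p - G.u (G.σ z.1)) + latVec b₁ b₂ (![(0 : ℤ × ℤ), loDir m₁, loDir m₂] i₀) := by abel
    rw [this]
    exact G.isLat_add (G.isLat_sub (hPL 0) hpL) (hB.isLat _)
  -- the bonds at the base partner `p`
  have base : ∀ c' ∈ G.layer (G.σ (z.1 + 1)), IsBond p c' ↔ ∃ i, c' = P i := by
    intro c' hc'
    constructor
    · intro hb
      obtain ⟨y, hy, hyc⟩ := hG.transfer hz (G.layer_sub hc') hb.1 hb.2
      have hyr := hG.reg_of_adj hz hy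
      have hy1 : y.1 = z.1 + 1 := hG.σinj ((hG.eq_σ_of_near_layer hyr hc' (by rw [← hyc]; exact (hG.ptn_reg hyr).2)).symm)
      obtain ⟨i, rfl⟩ := G.eq_up_of_adj hy hy1
      exact ⟨i, hyc.symm⟩
    · rintro ⟨i, rfl⟩
      have hd := hG.ptn_bond hzr (hur i) (G.adj_up z i)
      exact ⟨hd.1, by linarith [hd.2, hG.e4, hG.ε0]⟩
  have base' : ∀ c' ∈ G.layer (G.σ (z.1 + 1)),
      IsBond p c' ↔ ∃ j, c' - p = P 0 - p + latVec b₁ b₂ (![(0 : ℤ × ℤ), loDir m₁, loDir m₂] i₀) + latVec b₁ b₂ (triVert t j) := by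
    intro c' hc'
    rw [base c' hc']
    constructor
    · rintro ⟨i, rfl⟩
      obtain ⟨j, hj⟩ := hW1 i
      refine ⟨j, ?_⟩
      rw [add_assoc, ← latVec_add, ← hj, ← hW i]; abel
    · rintro ⟨j, hj⟩
      obtain ⟨i, hi⟩ := hW2 j
      refine ⟨i, ?_⟩
      rw [add_assoc, ← latVec_add, ← hi, ← hW i] at hj
      have : c' - p = P i - p := by rw [hj]; abel
      exact sub_left_injective this
  -- position independence
  intro c hc c' hc'
  have hc'' : p + (c' - c) ∈ G.layer (G.σ (z.1 + 1)) := G.layer_shift hc hc' hpL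
  rw [isBond_iff_of_sub_eq (show c' - c = (p + (c' - c)) - p by abel), base' _ hc'', add_sub_cancel_left]

/-! ### ZO-4  The linear chart -/

/-- ★★★ **THE LINEAR BARLOW CHART OF THE PARALLEL CASE (PROVED).**  Under `ParCfg.Hyp` there are origins `o`, a basis `b₁ b₂` and letters `τ'` such that
`linChart o b₁ b₂` is an exact Barlow bond chart of the crystal on the `RC`-ball about `x₀`, onto the ball sites, and compatible with the chart of `S`:
a moat atom of sheet `s` within `ε` of a chart site lies in chart sheet `s`. [this file] -/
theorem Hyp.linear_chart (hG : G.Hyp) : ∃ (o : ℤ → E3) (b₁ b₂ : E3) (τ' : ℤ → Bool),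
    IsBarlowBondChart G.C {y | dist (linChart o b₁ b₂ y) G.x₀ ≤ G.RC} (linChart o b₁ b₂) τ' ∧
      (∀ c ∈ G.C, dist c G.x₀ ≤ G.RC → ∃ y, linChart o b₁ b₂ y = c) ∧
      (∀ x, G.Ψ x ∈ moatIn G.S G.K G.r G.ℓ → ∀ y, dist (G.Ψ x) (linChart o b₁ b₂ y) ≤ G.ε → y.1 = x.1) := by
  obtain ⟨b₁, b₂, hB⟩ := hG.exists_basis
  -- cross data for every sheet (default where no good atom)
  have hex : ∀ k : ℤ, ∃ Δ t, G.IsLat (Δ - (G.u (G.σ (k + 1)) - G.u (G.σ k))) ∧ ((∃ z, G.Good z ∧ z.1 = k) →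
      ∀ c ∈ G.layer (G.σ k), ∀ c' ∈ G.layer (G.σ (k + 1)), IsBond c c' ↔ ∃ i : Fin 3, c' - c = Δ + latVec b₁ b₂ (triVert t i)) := by
    intro k
    by_cases h : ∃ z, G.Good z ∧ z.1 = k
    · obtain ⟨z, hz, rfl⟩ := h
      obtain ⟨Δ, t, hT⟩ := hG.exists_TP hB hz
      exact ⟨Δ, t, hT.1, fun _ => hT.2⟩
    · exact ⟨G.u (G.σ (k + 1)) - G.u (G.σ k), true, by rw [sub_self]; exact G.isLat_zero, fun h' => (h h').elim⟩
  choose Δ t hΔ hT using hex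
  obtain ⟨o, ho0, hos⟩ := exists_seq_of_increments (G.u (G.σ 0)) Δ
  have ho : ∀ k, o k ∈ G.layer (G.σ k) := by
    intro k
    induction k using Int.induction_on with
    | zero => show G.IsLat (o 0 - G.u (G.σ 0)); rw [ho0, sub_self]; exact G.isLat_zero
    | succ n ih =>
      have : o ((n : ℤ) + 1) - G.u (G.σ ((n : ℤ) + 1)) = (o n - G.u (G.σ n)) + (Δ n - (G.u (G.σ ((n : ℤ) + 1)) - G.u (G.σ n))) := by
        rw [hos]; abel
      show G.IsLat _
      rw [this]; exact G.isLat_add ih (hΔ n)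
    | pred n ih =>
      have e := hos (-(n : ℤ) - 1)
      rw [sub_add_cancel] at e
      have : o (-(n : ℤ) - 1) - G.u (G.σ (-(n : ℤ) - 1)) =
          (o (-(n : ℤ)) - G.u (G.σ (-(n : ℤ)))) - (Δ (-(n : ℤ) - 1) - (G.u (G.σ (-(n : ℤ) - 1 + 1)) - G.u (G.σ (-(n : ℤ) - 1)))) := by
        rw [e, sub_add_cancel]; abel
      show G.IsLat _
      rw [this]; exact G.isLat_sub ih (hΔ _)
  set Ψ' := linChart o b₁ b₂ with hΨ'
  have hΨL : ∀ y, Ψ' y ∈ G.layer (G.σ y.1) := fun y => by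
    rw [hΨ', show y = (y.1, y.2) from rfl, linChart_eq_latVec]; exact G.layer_add (ho y.1) (hB.isLat y.2)
  have hΨC : ∀ y, Ψ' y ∈ G.C := fun y => G.layer_sub (hΨL y)
  have hsub : ∀ y y', Ψ' y' - Ψ' y = (o y'.1 - o y.1) + latVec b₁ b₂ (y'.2 - y.2) := fun y y' => by
    rw [hΨ', show y = (y.1, y.2) from rfl, show y' = (y'.1, y'.2) from rfl, linChart_eq_latVec, linChart_eq_latVec, latVec_sub]; abel
  set D := {y | dist (Ψ' y) G.x₀ ≤ G.RC} with hD
  -- ball sheets carry good atoms and one layer index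
  have goodD : ∀ y ∈ D, (∃ z, G.Good z ∧ z.1 = y.1) ∧ ∀ m, Ψ' y ∈ G.layer m → m = G.σ y.1 := by
    intro y hy
    obtain ⟨z, hz, hm⟩ := hG.ball_layer hB (hΨC y) hy
    have h1 : z.1 = y.1 := hG.σinj (hm _ (hΨL y)).symm
    exact ⟨⟨z, hz, h1⟩, fun m hm' => by rw [hm m hm', h1]⟩
  -- one-sided exactness
  have sheets : ∀ y ∈ D, ∀ y' ∈ D, IsBond (Ψ' y) (Ψ' y') → y'.1 = y.1 ∨ y'.1 = y.1 + 1 ∨ y.1 = y'.1 + 1 := by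
    intro y hy y' hy' hb
    obtain ⟨⟨z, hz, hz1⟩, -⟩ := goodD y hy
    have hpL := hG.ptn_layer (hG.reg_of_good hz)
    rw [hz1] at hpL
    have hc'' := G.layer_shift (hΨL y) (hΨL y') hpL
    have hb' := (isBond_iff_of_sub_eq (show Ψ' y' - Ψ' y = (G.ptn (G.Ψ z) + (Ψ' y' - Ψ' y)) - G.ptn (G.Ψ z) by abel)).1 hb
    obtain ⟨w, hw, hwc⟩ := hG.transfer hz (G.layer_sub hc'') hb'.1 hb'.2
    have hwr := hG.reg_of_adj hz hw
    have hw1 : y'.1 = w.1 := hG.σinj (hG.eq_σ_of_near_layer hwr hc'' (by rw [← hwc]; exact (hG.ptn_reg hwr).2))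
    have := barlowAdj_sheets hw
    omega
  have fwd : ∀ y ∈ D, ∀ y', (y'.1 = y.1 ∨ y'.1 = y.1 + 1) → IsBond (Ψ' y) (Ψ' y') → BarlowAdj (fun k => !t k) y y' := by
    rintro y hy y' (h1 | h1) hb
    · have hv : Ψ' y' - Ψ' y = latVec b₁ b₂ (y'.2 - y.2) := by rw [hsub, h1, sub_self, zero_add]
      have hn : 0 < ‖Ψ' y' - Ψ' y‖ ∧ ‖Ψ' y' - Ψ' y‖ ≤ 28 / 25 := by rw [← dist_eq_norm, dist_comm]; exact hb
      rw [hv] at hn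
      obtain ⟨j, hj⟩ := (hB.short_iff hG (hB.isLat _)).1 hn
      exact Or.inl ⟨h1, j, (sub_eq_iff_eq_add'.1 (hB.inj hG hj))⟩
    · obtain ⟨⟨z, hz, hz1⟩, -⟩ := goodD y hy
      have hL' : Ψ' y' ∈ G.layer (G.σ (y.1 + 1)) := h1 ▸ hΨL y'
      obtain ⟨i, hi⟩ := (hT y.1 ⟨z, hz, hz1⟩ _ (hΨL y) _ hL').1 hb
      rw [hsub, h1, hos, add_sub_cancel_left, add_right_inj] at hi
      refine Or.inr (Or.inl ⟨h1, i, ?_⟩)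
      show y.2 = y'.2 + triVert (!t y.1) i
      rw [← neg_triVert, ← sub_eq_add_neg, ← hB.inj hG hi, sub_sub_cancel]
  have bwd : ∀ y ∈ D, ∀ y', (y'.1 = y.1 ∧ LoAdj y.2 y'.2) ∨ (y'.1 = y.1 + 1 ∧ CrossAdj (!t y.1) y.2 y'.2) → IsBond (Ψ' y) (Ψ' y') := by
    rintro y hy y' (⟨h1, j, hj⟩ | ⟨h1, i, hi⟩)
    · have hv : Ψ' y' - Ψ' y = latVec b₁ b₂ (loDir j) := by rw [hsub, h1, sub_self, zero_add, hj, add_sub_cancel_left]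
      have hn := (hB.short_iff hG (hB.isLat (loDir j))).2 ⟨j, rfl⟩
      rw [← hv, ← dist_eq_norm, dist_comm] at hn
      exact hn
    · obtain ⟨⟨z, hz, hz1⟩, -⟩ := goodD y hy
      have hL' : Ψ' y' ∈ G.layer (G.σ (y.1 + 1)) := h1 ▸ hΨL y'
      refine (hT y.1 ⟨z, hz, hz1⟩ _ (hΨL y) _ hL').2 ⟨i, ?_⟩
      rw [hsub, h1, hos, add_sub_cancel_left, add_right_inj, hi, sub_add_cancel_left, neg_triVert, Bool.not_not]
  refine ⟨o, b₁, b₂, fun k => !t k, ⟨?_, fun y _ => hΨC y, ?_⟩, ?_, ?_⟩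
  · -- injective on the ball
    intro y hy y' hy' h
    have h' : Ψ' y = Ψ' y' := h
    have h1 : y'.1 = y.1 := hG.σinj ((goodD y hy).2 _ (by rw [h']; exact hΨL y'))
    have h2 := hsub y y'
    rw [h', sub_self, h1, sub_self, zero_add] at h2
    have h3 : y'.2 - y.2 = 0 := hB.inj hG (by rw [← h2, latVec_zero])
    exact (Prod.ext h1 (sub_eq_zero.1 h3)).symm
  · -- exact
    intro y hy y' hy'
    constructor
    · intro hb
      rcases sheets y hy y' hy' hb with h1 | h1 | h1
      · exact fwd y hy y' (Or.inl h1) hb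
      · exact fwd y hy y' (Or.inr h1) hb
      · exact barlowAdj_symm (fwd y' hy' y (Or.inr h1) hb.symm)
    · rintro (h | h | h)
      · exact bwd y hy y' (Or.inl h)
      · exact bwd y hy y' (Or.inr h)
      · exact (bwd y' hy' y (Or.inr h)).symm
  · -- onto the ball sites
    intro c hc hd
    obtain ⟨yc, rfl⟩ := hc
    obtain ⟨z, hz, hm⟩ := hG.ball_layer hB (G.skel_mem yc) hd
    have hcL : G.skel yc ∈ G.layer (G.σ z.1) := (hm _ (G.skel_mem_layer yc)) ▸ G.skel_mem_layer yc
    obtain ⟨pc, hpc⟩ := hB.coords hG (G.isLat_of_layer (ho z.1) hcL)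
    exact ⟨(z.1, pc), by rw [linChart_eq_latVec, ← hpc, add_sub_cancel]⟩
  · -- compatible with the chart of S
    intro x hx y hy
    obtain ⟨pc, hpc⟩ := G.exists_skel_of_layer (hΨL y)
    have hy' : dist (G.Ψ x) (G.skel (G.σ y.1, pc)) ≤ G.ε := by rw [← hpc]; exact hy
    exact hG.σinj (hG.par x hx _ hy')

end ParCfg

end Summit.AtomisticToContinuum.Crystallization.Theorems.ChartedZeroExcessLayeredLatticeLiouville
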